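import Summits.Ventures.Crystal3D.Bulk.HullRotSysAngles
import Summits.Ventures.Crystal3D.Bulk.RotSysGaussBonnet
import Summits.Ventures.Crystal3D.Bulk.GapHullEulerCensus
import HarnessLib

/-!
# P-L3(b) L1 in the kernel: the tight graph of a census configuration is CONNECTED
# (`CensusRows c → TightConnected c`), and Euler's relation `V′ − E + F° = 2` unconditionally

HONEST FRAMING. Part of the venture `Summits/Ventures/Crystal3D` (cell `pub-crystal3d`, phase 2;
seat p3). Kernel theorems about an admissible fourteen-ball configuration `c`; nothing here
asserts anything about GAP(1.26). Until now the connectedness of the tight graph `T′` (the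
census's structural assumption P-L3(b) L1, `TightConnected c` of `Bulk/GapHullConnected.lean`)
was a HYPOTHESIS of the kernel's Euler / excess statements (`Bulk/GapHullEulerCensus.lean`,
`Bulk/GapExcess.lean`) and a «paper ×2» item of the census. This file PROVES it from the census
rows, by the combinatorial Gauss–Bonnet theorem `Bulk/RotSysGaussBonnet.lean` on the hull fan
rotation system weighted by the fan angles (`Bulk/HullRotSysAngles.lean`):

* **`IsGapConfig.cornerAt_tightDartsH`** — the corner of the tight sub-map at a tight dart
  `(i, j)` (the fan angles of the hull triangulation swept from the arc `i → j` to the next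
  tight arc, in the rotation sense of `σ_H`) IS the oriented gap `odartGap c i j` of
  `Bulk/GapOrientation.lean` (first return of `σ_H` = `onextNbr`, `Bulk/GapHullRotation.lean`;
  the fan angles between consecutive fan neighbours telescope along the lifted azimuth);
* **`IsGapConfig.tightConnected_of_odartGap_lt_pi`** — if every oriented gap is `< π`
  (no closed tangent half-plane contains the tight partners of a vertex: P-L2(a)), the tight
  graph is connected: Theorem B of `RotSysGaussBonnet` (`numK = 1`) +
  `IsGapConfig.tightConnected_of_numK_eq_one`;
* **`CensusRows.tightConnected`** — hence `TightConnected c` for EVERY configuration satisfying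
  the census rows (`CensusRows.odartGap_lt_pi`); and the formerly conditional consequences
  become unconditional census rows: **`CensusRows.oriented_euler`** (`V′ − E + F° = 2`),
  **`CensusRows.total_excess`** (`Σ_F excess = 4π`), **`CensusRows.tightCount_le_card`**
  (`E ≤ 3V′ − 6`), **`CensusRows.onumFaces_le_card`** (`F° ≤ 2V′ − 4`).

The paper proof (DESIGN-L12-THEORY P-L3(b) L1) is Gauss–Bonnet for an annular face; the kernel
proof never leaves the combinatorics of the hull rotation system: the only geometric inputs are
«fan triangle angle sum ≥ π» (Girard, Literature `sphExcess_nonneg`) and «fan angles at a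
vertex sum to 2π».
-/

noncomputable section

namespace Summit.Ventures.Crystal3D

open Literature.Geometry.DiscreteGeometry Finset Equiv HullRotSys Real InnerProductGeometry

variable {c : Fin 14 → EuclideanSpace ℝ (Fin 3)}

/-! ## The corner of the tight sub-map at a tight dart is the oriented gap -/

/-- **First return of `σ_H` to the tight darts, with the swept fan angles summed**: for `i ≠ 0`
and a tight partner `j` there is `n ≥ 1` with `σ_H^[n] (u_i, u_j) = (u_i, u_{onextNbr c i j})`,
no earlier positive iterate tight, and the fan angles of the `n` swept sectors summing to
`odartGap c i j`. (Refines `IsGapConfig.hullSucc_firstReturn_onextNbr`.) -/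
theorem IsGapConfig.hullSucc_firstReturn_sum (hc : IsGapConfig c)
    (hD : intruderDist c < 3 / 2) {i j : Fin 14} (hi0 : i ≠ 0) (hj : j ∈ tightNbrs c i) :
    ∃ n : ℕ, 0 < n ∧
      (hullSucc (dirSet c))^[n] (gapDir c i, gapDir c j) =
        (gapDir c i, gapDir c (onextNbr c i j)) ∧
      (∀ m : ℕ, 0 < m → m < n →
        ((hullSucc (dirSet c))^[m] (gapDir c i, gapDir c j)).2 ∉
          (tightNbrs c i).image (gapDir c)) ∧
      ∑ t ∈ range n, fanAngle (dirSet c) ((hullSucc (dirSet c))^[t] (gapDir c i, gapDir c j)) =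
        odartGap c i j := by
  classical
  have hD3 := hc.sq_lt_three_of_lt hD
  have hy : ‖gapDir c i‖ = 1 := hc.norm_gapDir hi0
  have hX1 := hc.norm_of_mem_dirSet
  have h0 := hc.zero_mem_interior_convexHull_dirSet
  have hfan : gapDir c j ∈ fanNbrs (dirSet c) (gapDir c i) :=
    mk_mem_hullDarts_iff.1 (hc.mk_mem_hullDarts_of_tight hD hi0 hj)
  obtain ⟨E⟩ := nonempty_nbrEnum hX1 hy ⟨gapDir c j, hfan⟩
  obtain ⟨k, hd⟩ := hc.exists_card_tightAngles_eq_succ hD3 hi0 ⟨j, hj⟩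
  obtain ⟨m, rfl⟩ := hc.exists_tightNbrAt_eq hD3 hi0 hd hj
  have hsurj : ∀ p : Fin (k + 1), ∃ q : ℕ, q < E.d ∧ E.nb q = gapDir c (tightNbrAt c i hd p) :=
    fun p => E.surj _ (mk_mem_hullDarts_iff.1
      (hc.mk_mem_hullDarts_of_tight hD hi0 (tightNbrAt_mem c i hd p)))
  choose K hK using hsurj
  have hKm : K m < E.d := (hK m).1
  have hK0 : K 0 < E.d := (hK 0).1
  have hKlast : K (Fin.last k) < E.d := (hK (Fin.last k)).1
  have hKlt := fun p q (h : p < q) => tightPos_lt_of_lt hc hi0 hd E K hK h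
  have hrefl := fun p q (h : K p < K q) => lt_of_tightPos_lt hc hi0 hd E K hK h
  have hrec := fun q (hq : q < E.d) ht => exists_tightPos_eq hc hi0 hd E K hK hD hq ht
  have haz := fun p => tightPos_azimuth hc hi0 hd E K hK p
  have hlift : ∀ p, liftAz E (K p) = sortedTightAngle c i hd p := fun p => by
    rw [liftAz_of_lt E (hK p).1, haz]
  have hd0 := E.d_pos
  -- the weight of a sector in terms of the enumeration
  have hwt : ∀ q, fanAngle (dirSet c) (gapDir c i, E.nb q) =
      angle (perpTo (gapDir c i) (E.nb q)) (perpTo (gapDir c i) (succV (dirSet c) (gapDir c i)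
        (E.nb q))) := fun q => rfl
  rw [← (hK m).2]
  rcases frameDet_eq_one_or c i with hdet1 | hdetm
  · -- right-handed frame: `σ_H` and `onextNbr = nextNbr` both step FORWARD in azimuth
    have hdet : 0 < orient3 (tangentFrame (gapDir c i) hy 0) (tangentFrame (gapDir c i) hy 1)
        (tangentFrame (gapDir c i) hy 2) := by rw [← frameDet_eq hy, hdet1]; exact one_pos
    have hit := iterate_hullSucc_nb_of_det_pos hX1 h0 E hdet
    have honext : onextNbr c i (tightNbrAt c i hd m) = tightNbrAt c i hd (finRotate (k + 1) m) := by
      unfold onextNbr; rw [if_pos hdet1, nextNbr_tightNbrAt]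
    have hgap : odartGap c i (tightNbrAt c i hd m) = tightGap c i hd m := by
      unfold odartGap; rw [if_pos hdet1, dartGap_tightNbrAt]
    -- the swept fan angles telescope along the lifted azimuth
    have hsum : ∀ n, ∑ t ∈ range n, fanAngle (dirSet c)
        ((hullSucc (dirSet c))^[t] (gapDir c i, E.nb (K m))) = liftAz E (K m + n) - liftAz E (K m) := by
      intro n
      rw [← sum_angle_nb_eq_liftAz_sub hX1 h0 E (K m) n]
      refine Finset.sum_congr rfl fun t _ => ?_
      rw [hit, hwt, succV_nb_of_det_pos hX1 h0 E hdet]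
    rw [honext, ← (hK (finRotate (k + 1) m)).2, hgap]
    by_cases hlast : m = Fin.last k
    · -- wrap-around: the successor is position `0`
      have hrot : finRotate (k + 1) m = 0 := by rw [hlast]; exact finRotate_last
      rw [hrot]
      refine ⟨E.d - K m + K 0, by have := (hK m).1; omega, ?_, ?_, ?_⟩
      · rw [hit, show K m + (E.d - K m + K 0) = K 0 + E.d by have := (hK m).1; omega,
          E.periodic]
      · intro n hn0 hn ht
        rw [hit] at ht
        simp only at ht
        by_cases hlt : K m + n < E.d
        · obtain ⟨p, hp⟩ := hrec _ hlt ht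
          have : m < p := hrefl m p (by omega)
          rw [hlast] at this
          exact absurd this (not_lt.2 (Fin.le_last p))
        · have hper : E.nb (K m + n) = E.nb (K m + n - E.d) := by
            conv_lhs => rw [show K m + n = (K m + n - E.d) + E.d by omega, E.periodic]
          rw [hper] at ht
          obtain ⟨p, hp⟩ := hrec _ (by omega) ht
          have : p < 0 := hrefl p 0 (by omega)
          exact absurd this (not_lt.2 (Fin.zero_le p))
      · rw [hsum, show K m + (E.d - K m + K 0) = K 0 + E.d by have := (hK m).1; omega,
          liftAz_add_d, hlift, hlift, hlast]
        unfold tightGap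
        rw [if_pos rfl, finRotate_last]
        ring
    · -- interior: the successor is position `m + 1`
      have hval : ((finRotate (k + 1) m : Fin (k + 1)) : ℕ) = (m : ℕ) + 1 := by
        rw [finRotate_apply, Fin.val_add_one, if_neg hlast]
      have hmlt : m < finRotate (k + 1) m := by
        rw [Fin.lt_def, hval]; exact Nat.lt_succ_self _
      have hKml : K m < K (finRotate (k + 1) m) := hKlt _ _ hmlt
      refine ⟨K (finRotate (k + 1) m) - K m, by omega, ?_, ?_, ?_⟩
      · rw [hit, Nat.add_sub_cancel' hKml.le]
      · intro n hn0 hn ht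
        rw [hit] at ht
        simp only at ht
        obtain ⟨p, hp⟩ := hrec _ (by have := (hK (finRotate (k + 1) m)).1; omega) ht
        have h1 : m < p := hrefl m p (by omega)
        have h2 : p < finRotate (k + 1) m := hrefl p _ (by omega)
        rw [Fin.lt_def] at h1 h2
        omega
      · rw [hsum, Nat.add_sub_cancel' hKml.le, hlift, hlift]
        unfold tightGap
        rw [if_neg hlast]
        ring
  · -- left-handed frame: `σ_H` and `onextNbr = prevNbr` both step BACKWARD in azimuth
    have hne1 : frameDet c i ≠ 1 := by rw [hdetm]; norm_num
    have hdet : orient3 (tangentFrame (gapDir c i) hy 0) (tangentFrame (gapDir c i) hy 1)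
        (tangentFrame (gapDir c i) hy 2) < 0 := by
      rw [← frameDet_eq hy, hdetm]; norm_num
    have hit := fun n q (h : n ≤ q) =>
      iterate_hullSucc_nb_of_det_neg hX1 h0 E hdet (n := n) (k := q) h
    have honext : onextNbr c i (tightNbrAt c i hd m) =
        tightNbrAt c i hd ((finRotate (k + 1)).symm m) := by
      unfold onextNbr; rw [if_neg hne1, prevNbr_tightNbrAt]
    set m' := (finRotate (k + 1)).symm m with hm'
    have hmm' : m = finRotate (k + 1) m' := by rw [hm', Equiv.apply_symm_apply]
    have hgap : odartGap c i (tightNbrAt c i hd m) = tightGap c i hd m' := by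
      unfold odartGap; rw [if_neg hne1, prevNbr_tightNbrAt, ← hm', dartGap_tightNbrAt]
    -- the swept fan angles telescope (downwards) along the lifted azimuth
    have hsum : ∀ n, n ≤ K m + E.d → ∑ t ∈ range n, fanAngle (dirSet c)
        ((hullSucc (dirSet c))^[t] (gapDir c i, E.nb (K m + E.d))) =
          liftAz E (K m + E.d) - liftAz E (K m + E.d - n) := by
      intro n hn
      have hterm : ∀ t ∈ range n, fanAngle (dirSet c)
          ((hullSucc (dirSet c))^[t] (gapDir c i, E.nb (K m + E.d))) =
            liftAz E (K m + E.d - n + (n - 1 - t) + 1) - liftAz E (K m + E.d - n + (n - 1 - t)) := by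
        intro t ht
        rw [mem_range] at ht
        rw [hit t _ (by omega), hwt, show K m + E.d - t = (K m + E.d - n + (n - 1 - t)) + 1 by omega,
          succV_nb_of_det_neg hX1 h0 E hdet, angle_comm, angle_nb_succ_eq_liftAz_sub hX1 h0 E]
      rw [Finset.sum_congr rfl hterm, Finset.sum_range_reflect (fun t =>
        liftAz E (K m + E.d - n + t + 1) - liftAz E (K m + E.d - n + t)) n]
      have h := Finset.sum_range_sub (fun t => liftAz E (K m + E.d - n + t)) n
      simp only [Nat.add_zero] at h
      rw [show K m + E.d - n + n = K m + E.d by omega] at h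
      rw [← h]
      exact Finset.sum_congr rfl fun t _ => by rw [Nat.add_assoc]
    rw [honext, ← (hK m').2, hgap]
    have hstart : E.nb (K m) = E.nb (K m + E.d) := (E.periodic _).symm
    rw [hstart]
    by_cases hlast : m' = Fin.last k
    · -- wrap-around: `m = 0`, the predecessor is the LAST position
      have hm0 : m = 0 := by rw [hmm', hlast]; exact finRotate_last
      refine ⟨K m + E.d - K m', by have := (hK m').1; omega, ?_, ?_, ?_⟩
      · rw [hit _ _ (by omega), show K m + E.d - (K m + E.d - K m') = K m' by
          have := (hK m').1; omega]
      · intro n hn0 hn ht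
        rw [hit _ _ (by have := (hK m').1; omega)] at ht
        simp only at ht
        by_cases hge : E.d ≤ K m + E.d - n
        · have hper : E.nb (K m + E.d - n) = E.nb (K m + E.d - n - E.d) := by
            conv_lhs => rw [show K m + E.d - n = (K m + E.d - n - E.d) + E.d by omega, E.periodic]
          rw [hper] at ht
          obtain ⟨p, hp⟩ := hrec _ (by omega) ht
          have : p < m := hrefl p m (by omega)
          rw [hm0] at this
          exact absurd this (not_lt.2 (Fin.zero_le p))
        · obtain ⟨p, hp⟩ := hrec _ (by omega) ht
          have : m' < p := hrefl m' p (by have := (hK m').1; omega)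
          rw [hlast] at this
          exact absurd this (not_lt.2 (Fin.le_last p))
      · rw [hsum _ (by have := (hK m').1; omega), show K m + E.d - (K m + E.d - K m') = K m' by
          have := (hK m').1; omega, liftAz_add_d, hlift, hlift, hlast, hm0]
        unfold tightGap
        rw [if_pos rfl, finRotate_last]
        ring
    · -- interior: `m = m' + 1`, the predecessor is position `m'`
      have hval : ((m : Fin (k + 1)) : ℕ) = (m' : ℕ) + 1 := by
        rw [hmm', finRotate_apply, Fin.val_add_one, if_neg hlast]
      have hm'lt : m' < m := by rw [Fin.lt_def, hval]; exact Nat.lt_succ_self _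
      have hKml : K m' < K m := hKlt _ _ hm'lt
      refine ⟨K m - K m', by omega, ?_, ?_, ?_⟩
      · rw [hit _ _ (by omega), show K m + E.d - (K m - K m') = K m' + E.d by omega, E.periodic]
      · intro n hn0 hn ht
        rw [hit _ _ (by omega), show K m + E.d - n = (K m - n) + E.d by omega, E.periodic] at ht
        simp only at ht
        obtain ⟨p, hp⟩ := hrec _ (by have := (hK m).1; omega) ht
        have h1 : m' < p := hrefl m' p (by omega)
        have h2 : p < m := hrefl p m (by omega)
        rw [Fin.lt_def] at h1 h2
        omega
      · rw [hsum _ (by omega), show K m + E.d - (K m - K m') = K m' + E.d by omega,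
          liftAz_add_d, liftAz_add_d, hlift, hlift]
        unfold tightGap
        rw [if_neg hlast, ← hmm']
        ring

/-- **The corner of the tight sub-map at a tight dart is the oriented gap**: for a tight dart
`d ↦ (i, j)`, the corner `cornerAt σ_H (fan angles) (tight darts) d` — the fan angles swept
from the arc `i → j` to the next tight arc at `i` — equals `odartGap c i j`. -/
theorem IsGapConfig.cornerAt_tightDartsH (hc : IsGapConfig c) (hD : intruderDist c < 3 / 2)
    {q : Fin 14 × Fin 14} (hq : q ∈ darts c) {d : ↥(hullDarts (dirSet c))}
    (hd : d.1 = dirPair c q) :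
    RotSys.cornerAt hc.hullRot (dartWeight (dirSet c)) (tightDartsH c) d = odartGap c q.1 q.2 := by
  have hD2 : intruderDist c < 2 := by linarith
  obtain ⟨hi0, -, -, -⟩ := mem_darts.1 hq
  have hj : q.2 ∈ tightNbrs c q.1 := snd_mem_tightNbrs_of_mem_darts hq
  obtain ⟨n, hn0, hit, hmin, hsum⟩ := hc.hullSucc_firstReturn_sum hD hi0 hj
  have hq' : (q.1, onextNbr c q.1 q.2) ∈ darts c :=
    mk_mem_darts hi0 (hc.onextNbr_mem (hc.sq_lt_three_of_lt hD) hi0 hj)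
  have hdT : d ∈ tightDartsH c := mem_tightDartsH.2 ⟨q, hq, hd.symm⟩
  -- the first return of `σ_H` on the dart type lands in the tight darts at time `n`
  have hret : RotSys.retTime hc.hullRot (tightDartsH c) d = n := by
    refine RotSys.retTime_eq_of_first_return _ hdT hn0 ?_ ?_
    · refine mem_tightDartsH.2 ⟨_, hq', ?_⟩
      unfold IsGapConfig.hullRot
      rw [rot_pow_apply_val, hd]
      exact hit.symm
    · intro m hm0 hmn hmem
      obtain ⟨q', hq'd, hq'e⟩ := mem_tightDartsH.1 hmem
      unfold IsGapConfig.hullRot at hq'e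
      rw [rot_pow_apply_val, hd] at hq'e
      have hfst : gapDir c q'.1 = gapDir c q.1 := by
        have := congrArg Prod.fst hq'e
        rw [iterate_hullSucc_fst] at this
        exact this
      have hq'1 : q'.1 = q.1 := hc.eq_of_gapDir_eq hD2 (mem_darts.1 hq'd).1 hi0 hfst
      apply hmin m hm0 hmn
      have hq'e' : (hullSucc (dirSet c))^[m] (gapDir c q.1, gapDir c q.2) = dirPair c q' :=
        hq'e.symm
      rw [hq'e']
      exact mem_image.2 ⟨q'.2, hq'1 ▸ snd_mem_tightNbrs_of_mem_darts hq'd, rfl⟩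
  unfold RotSys.cornerAt
  rw [hret, ← hsum]
  refine Finset.sum_congr rfl fun t _ => ?_
  rw [dartWeight_apply]
  unfold IsGapConfig.hullRot
  rw [rot_pow_apply_val, hd]
  rfl

/-! ## Connectedness -/

/-- **P-L2(a) implies P-L3(b) L1: if every oriented gap is `< π`, the tight graph is
CONNECTED.** (Combinatorial Gauss–Bonnet, `RotSys.IsRotSys.numK_eq_one_of_cornerAt_lt_pi`, on
the hull fan rotation system weighted by the fan angles.) -/
theorem IsGapConfig.tightConnected_of_odartGap_lt_pi (hc : IsGapConfig c)
    (hD : intruderDist c < 3 / 2) (hne : (darts c).Nonempty)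
    (hlt : ∀ i j : Fin 14, i ≠ 0 → j ∈ tightNbrs c i → odartGap c i j < π) :
    TightConnected c := by
  refine hc.tightConnected_of_numK_eq_one hD ?_
  have hrs : RotSys.IsRotSys hc.hullRot (inv (dirSet c)) := isRotSys
  have hT : (tightDartsH c).Nonempty := by
    obtain ⟨q, hq⟩ := hne
    exact ⟨⟨dirPair c q, hc.dirPair_mem_hullDarts hD hq⟩, mem_tightDartsH.2 ⟨q, hq, rfl⟩⟩
  refine hrs.numK_eq_one_of_cornerAt_lt_pi (dartWeight (dirSet c)) chi2_univ_eq_numK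
    conn_univ excess_univ_nonneg cornerAt_singleton_le_two_pi (isClosed_tightDartsH c) hT ?_
  intro d hdT
  obtain ⟨q, hq, hqd⟩ := mem_tightDartsH.1 hdT
  rw [hc.cornerAt_tightDartsH hD hq hqd.symm]
  exact hlt q.1 q.2 (mem_darts.1 hq).1 (snd_mem_tightNbrs_of_mem_darts hq)

/-- **P-L3(b) L1 in the kernel: the tight graph of every configuration satisfying the census
rows is connected.** -/
theorem CensusRows.tightConnected (h : CensusRows c) : TightConnected c :=
  h.isGapConfig.tightConnected_of_odartGap_lt_pi h.intruderDist_lt_three_halves h.darts_nonempty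
    fun _ _ hi0 hj => h.odartGap_lt_pi hi0 hj

/-! ## The Euler consequences, now unconditional under the census rows -/

/-- **Euler's relation `V′ − E + F° = 2` for the oriented tight map of every census
configuration** (unconditional: connectedness is `CensusRows.tightConnected`). -/
theorem CensusRows.oriented_euler (h : CensusRows c) :
    ((activeVertices c).card : ℤ) - tightCount c + onumFaces c = 2 :=
  h.oriented_euler_of_tightConnected h.tightConnected

/-- **Total angular excess `4π`** for every census configuration:
`Σ_{F ∈ ofaces c} (Σ corners − (#F − 2)π) = 4π`. -/
theorem CensusRows.total_excess (h : CensusRows c) :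
    ∑ F ∈ ofaces c, (ofaceAngleSum c F - ((F.card : ℝ) - 2) * Real.pi) = 4 * Real.pi :=
  h.total_excess_of_tightConnected h.tightConnected

/-- **`E ≤ 3V′ − 6`** for every census configuration. -/
theorem CensusRows.tightCount_le_card (h : CensusRows c) :
    tightCount c + 6 ≤ 3 * (activeVertices c).card :=
  h.tightCount_le_of_tightConnected h.tightConnected

/-- **`F° ≤ 2V′ − 4`** for every census configuration. -/
theorem CensusRows.onumFaces_le_card (h : CensusRows c) :
    onumFaces c + 4 ≤ 2 * (activeVertices c).card :=
  h.onumFaces_le_of_tightConnected h.tightConnected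

end Summit.Ventures.Crystal3D
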